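import Literature.RepresentationTheory.Semisimple.SimpleEigenvalueDescent
import Literature.RepresentationTheory.Semisimple.Semisimplification
import Literature.RepresentationTheory.Semisimple.IrreducibleOfCharpoly
import Literature.RepresentationTheory.Semisimple.BrauerNesbitt
import Mathlib.FieldTheory.IsAlgClosed.Basic
import HarnessLib

/-!
# Rational forms in rank `≤ 3`: a representation all of whose eigenvalues lie in a subfield
# `L` has an `L`-valued semisimplification, and a semisimple one is conjugate into `GL_n(L)`

Topic `Literature/RepresentationTheory/Semisimple`; sequel of `SimpleEigenvalueDescent.lean`
(scalar criterion `forall_eq_smul_one_of_forall_charpoly_eq_pow`, simple-eigenvalue descent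
`exists_conj_apply_mem_of_simple_eigenvalue`) and of `Semisimplification.lean` (dévissage along a
stable subspace, block-diagonal sums).  Everything here is PROVED; no definitions, no named facts.

Let `k` be algebraically closed of characteristic `0`, `L ⊆ k` a subfield, `G` a group,
`n ≤ 3`, and `φ : G → GL_n(k)` a homomorphism such that every root of every `charpoly φ(g)` lies
in `L` ("all eigenvalues `L`-rational").

* `exists_conj_apply_mem_of_isIrreducible_of_le_three`: if `kⁿ` is irreducible, `φ` is
  `GL_n(k)`-conjugate to an `L`-valued homomorphism.  Indeed a split monic polynomial of degree
  `≤ 3` either has a simple root — an `L`-rational simple eigenvalue, and the simple-eigenvalue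
  descent applies — or is `(X - c)^n`; if the latter happens for EVERY `g`, the scalar criterion
  makes `φ` scalar, hence `L`-valued as it stands.
* `exists_semisimple_apply_mem_of_le_three`: in general there is an `L`-valued `ψ : G → GL_n(k)`
  with semisimple `kⁿ`, the same characteristic polynomials and `ker φ ≤ ker ψ` (dévissage as in
  `exists_semisimplification`, conjugating the irreducible blocks by the previous result; the
  eigenvalues of the diagonal blocks are among those of `φ`).
* `exists_conj_apply_mem_of_isSemisimple_of_le_three`: if `kⁿ` is semisimple, `φ` itself is
  `GL_n(k)`-conjugate to an `L`-valued homomorphism (Brauer–Nesbitt,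
  `Representation.nonempty_equiv_of_charpoly_eq`, turns "same characteristic polynomials" into
  conjugacy).

Rank `≤ 3` is sharp for this formulation: from rank `4` on, an irreducible representation all of
whose elements have a repeated eigenvalue need not be definable over the field generated by its
eigenvalues (local Schur indices).  The results are the algebraic half of the Sen-free rank-`3`
case of `Literature.NumberTheory.Automorphic.BLGGT2014_polarized_compatibleSystem_rationalModels`
(`PolarizedCompatibleSystemRationalModelsProofs.lean`): there the Galois representations attached
to a regular algebraic polarized cuspidal `π` on `GL_3` either have a Frobenius element with three
distinct eigenvalues ([BLGGT]'s regular element, Lemma 5.3.1 (3)) or have ALL their eigenvalues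
in the completion of the Hecke field, and the present file descends them.

## References

* C. W. Curtis, I. Reiner, *Methods of Representation Theory* I, Wiley (1981), §16B
  (semisimplification), §27 (Burnside), §36.
* N. Bourbaki, *Algèbre* VIII (2012), § 20 n° 6 (Brauer–Nesbitt). [BourbakiAlgebreVIII2012]
* T. Barnet-Lamb, T. Gee, D. Geraghty, R. Taylor, *Potential automorphy and change of weight*,
  Ann. of Math. 179 (2014), Lemma 5.3.1 (3), Lemma 5.3.2. [BarnetlambEtAl2014]
-/

noncomputable section

open scoped MatrixGroups
open Matrix Polynomial Module Literature.NumberTheory.GaloisRepresentations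

namespace Literature.RepresentationTheory.Semisimple

universe u v

variable {k : Type u} [Field k]

/-! ### Polynomial inputs -/

/-- A product `∏ (X - r)` over roots `r ∈ L` has coefficients in `L`. [folklore] -/
theorem coeff_multiset_prod_X_sub_C_mem (L : Subfield k) (s : Multiset k) (hs : ∀ r ∈ s, r ∈ L)
    (i : ℕ) : ((s.map fun a => X - C a).prod).coeff i ∈ L := by
  induction s using Multiset.induction_on generalizing i with
  | empty =>
    rw [Multiset.map_zero, Multiset.prod_zero, coeff_one]
    split_ifs
    · exact one_mem L
    · exact zero_mem L
  | cons a s ih =>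
    rw [Multiset.map_cons, Multiset.prod_cons, sub_mul, coeff_sub, coeff_C_mul]
    have ha : a ∈ L := hs a (Multiset.mem_cons_self a s)
    have hs' : ∀ r ∈ s, r ∈ L := fun r hr => hs r (Multiset.mem_cons_of_mem hr)
    refine sub_mem ?_ (mul_mem ha (ih hs' i))
    cases i with
    | zero =>
      rw [coeff_X_mul_zero]
      exact zero_mem L
    | succ j =>
      rw [coeff_X_mul]
      exact ih hs' j

/-- A multiset with at most three elements either has an element of multiplicity one or is
constant. [folklore] -/
theorem exists_count_eq_one_or_forall_eq {α : Type*} [DecidableEq α] (s : Multiset α)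
    (hs : Multiset.card s ≤ 3) :
    (∃ a ∈ s, s.count a = 1) ∨ ∀ a ∈ s, ∀ b ∈ s, a = b := by
  by_cases h : ∃ a ∈ s, s.count a = 1
  · exact Or.inl h
  push Not at h
  refine Or.inr fun a ha b hb => ?_
  by_contra hab
  have h2 : ∀ x ∈ s, 2 ≤ s.count x := fun x hx => by
    have h1 : 1 ≤ s.count x := Multiset.one_le_count_iff_mem.mpr hx
    have h3 := h x hx
    omega
  have hsum := Multiset.toFinset_sum_count_eq s
  have hsub : ({a, b} : Finset α) ⊆ s.toFinset := by
    intro x hx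
    rw [Finset.mem_insert, Finset.mem_singleton] at hx
    rw [Multiset.mem_toFinset]
    rcases hx with rfl | rfl
    · exact ha
    · exact hb
  have hle := Finset.sum_le_sum_of_subset (f := fun x => s.count x) hsub
  rw [Finset.sum_pair hab, hsum] at hle
  have h4 := h2 a ha
  have h5 := h2 b hb
  omega

open Classical in
/-- **Trichotomy for characteristic polynomials in rank `≤ 3`** over an algebraically closed
field: `charpoly A` either has a SIMPLE root `α` — `charpoly A = (X - α) · R` with `R(α) ≠ 0`,
`R = ∏_{r ∈ roots ∖ {α}} (X - r)` — or equals `(X - c)^n`. [folklore] -/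
theorem charpoly_eq_X_sub_C_mul_or_eq_pow [IsAlgClosed k] {n : ℕ} (hn : n ≤ 3)
    (A : Matrix (Fin n) (Fin n) k) :
    (∃ α ∈ A.charpoly.roots,
      A.charpoly = (X - C α) * ((A.charpoly.roots.erase α).map fun a => X - C a).prod ∧
        (((A.charpoly.roots.erase α).map fun a => X - C a).prod).eval α ≠ 0) ∨
    ∃ c : k, A.charpoly = (X - C c) ^ n := by
  set s := A.charpoly.roots with hsdef
  have hcard : Multiset.card s = n := by
    rw [hsdef, IsAlgClosed.card_roots_eq_natDegree, Matrix.charpoly_natDegree_eq_dim,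
      Fintype.card_fin]
  have hprod : (s.map fun a => X - C a).prod = A.charpoly :=
    prod_multiset_X_sub_C_of_monic_of_roots_card_eq (Matrix.charpoly_monic A)
      (by rw [IsAlgClosed.card_roots_eq_natDegree])
  rcases exists_count_eq_one_or_forall_eq s (hcard ▸ hn) with ⟨a, ha, hcount⟩ | hconst
  · refine Or.inl ⟨a, ha, ?_, ?_⟩
    · conv_lhs => rw [← hprod, ← Multiset.cons_erase ha]
      rw [Multiset.map_cons, Multiset.prod_cons]
    · rw [eval_multiset_prod, Multiset.map_map, Ne, Multiset.prod_eq_zero_iff, Multiset.mem_map]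
      rintro ⟨r, hr, hr0⟩
      rw [Function.comp_apply, eval_sub, eval_X, eval_C, sub_eq_zero] at hr0
      rw [← hr0] at hr
      have h1 : 0 < (s.erase a).count a := Multiset.count_pos.mpr hr
      rw [Multiset.count_erase_self, hcount] at h1
      exact absurd h1 (by decide)
  · right
    rcases Multiset.empty_or_exists_mem s with h0 | ⟨c, hc⟩
    · refine ⟨0, ?_⟩
      have hn0 : n = 0 := by rw [← hcard, h0, Multiset.card_zero]
      subst hn0
      rw [← hprod, h0, Multiset.map_zero, Multiset.prod_zero, pow_zero]
    · refine ⟨c, ?_⟩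
      have hsc : s = Multiset.replicate (Multiset.card s) c :=
        Multiset.eq_replicate_card.mpr fun b hb => hconst b hb c hc
      rw [← hprod, hsc, Multiset.map_replicate, Multiset.prod_replicate, hcard]

section

variable {G : Type v} [Group G]

/-- The matrices of `φ` as a function (local abbreviation-free helper): multiplicativity.
[folklore] -/
theorem coe_map_mul_GL {n : ℕ} (φ : G →* GL (Fin n) k) (g h : G) :
    (((φ (g * h) : GL (Fin n) k)) : Matrix (Fin n) (Fin n) k) =
      ((φ g : GL (Fin n) k) : Matrix (Fin n) (Fin n) k) * ((φ h : GL (Fin n) k) : Matrix _ _ k) := by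
  rw [map_mul, Units.val_mul]

/-- If all eigenvalues of all `φ(g)` lie in `L`, so do all coefficients of all `charpoly φ(g)`
(`k` algebraically closed). [folklore] -/
theorem coeff_charpoly_mem_of_roots_mem [IsAlgClosed k] (L : Subfield k) {n : ℕ}
    (φ : G →* GL (Fin n) k)
    (heig : ∀ g, ∀ r ∈ ((φ g : GL (Fin n) k) : Matrix (Fin n) (Fin n) k).charpoly.roots, r ∈ L)
    (g : G) (i : ℕ) : ((φ g : GL (Fin n) k) : Matrix (Fin n) (Fin n) k).charpoly.coeff i ∈ L := by
  rw [← prod_multiset_X_sub_C_of_monic_of_roots_card_eq (Matrix.charpoly_monic _)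
    (by rw [IsAlgClosed.card_roots_eq_natDegree])]
  exact coeff_multiset_prod_X_sub_C_mem L _ (heig g) i

/-- … and so do all traces. [folklore] -/
theorem trace_mem_of_roots_mem [IsAlgClosed k] (L : Subfield k) {n : ℕ} (φ : G →* GL (Fin n) k)
    (heig : ∀ g, ∀ r ∈ ((φ g : GL (Fin n) k) : Matrix (Fin n) (Fin n) k).charpoly.roots, r ∈ L)
    (g : G) : ((φ g : GL (Fin n) k) : Matrix (Fin n) (Fin n) k).trace ∈ L := by
  rcases Nat.eq_zero_or_pos n with rfl | hn
  · rw [Matrix.trace, Finset.univ_eq_empty, Finset.sum_empty]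
    exact zero_mem L
  · haveI : Nonempty (Fin n) := ⟨⟨0, hn⟩⟩
    rw [Matrix.trace_eq_neg_charpoly_coeff]
    exact neg_mem (coeff_charpoly_mem_of_roots_mem L φ heig g _)

/-- **Irreducible representations of rank `≤ 3` with `L`-rational eigenvalues are conjugate into
`GL_n(L)`** (`k` algebraically closed of characteristic `0`).  Either some `charpoly φ(g)` has a
simple root — `L`-rational, with `L`-rational cofactor — and the simple-eigenvalue descent
`exists_conj_apply_mem_of_simple_eigenvalue_of_isIrreducible` applies, or every `charpoly φ(g)`
is `(X - c_g)^n` (`charpoly_eq_X_sub_C_mul_or_eq_pow`) and `φ` is scalar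
(`forall_eq_smul_one_of_forall_charpoly_eq_pow_of_isIrreducible`), already `L`-valued.
[folklore] -/
theorem exists_conj_apply_mem_of_isIrreducible_of_le_three [IsAlgClosed k] [CharZero k]
    (L : Subfield k) {n : ℕ} (hn : n ≤ 3) (φ : G →* GL (Fin n) k)
    [Representation.IsIrreducible ((glStdRepresentation (Fin n) k).comp φ)]
    (heig : ∀ g, ∀ r ∈ ((φ g : GL (Fin n) k) : Matrix (Fin n) (Fin n) k).charpoly.roots, r ∈ L) :
    ∃ P : GL (Fin n) k, ∀ g i j,
      ((P * φ g * P⁻¹ : GL (Fin n) k) : Matrix (Fin n) (Fin n) k) i j ∈ L := by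
  classical
  have htr := trace_mem_of_roots_mem L φ heig
  by_cases hsimple : ∃ (g : G) (α : k) (R : k[X]),
      ((φ g : GL (Fin n) k) : Matrix (Fin n) (Fin n) k).charpoly = (X - C α) * R ∧
        R.eval α ≠ 0 ∧ α ∈ L ∧ ∀ i, R.coeff i ∈ L
  · obtain ⟨g, α, R, hch, hRα, hα, hR⟩ := hsimple
    exact exists_conj_apply_mem_of_simple_eigenvalue_of_isIrreducible L φ htr g α hα R hR hch hRα
  · have hall : ∀ g, ∃ c : k,
        ((φ g : GL (Fin n) k) : Matrix (Fin n) (Fin n) k).charpoly = (X - C c) ^ n := fun g => by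
      rcases charpoly_eq_X_sub_C_mul_or_eq_pow hn ((φ g : GL (Fin n) k) : Matrix (Fin n) (Fin n) k)
        with ⟨α, hαs, hch, hRα⟩ | h
      · exact absurd ⟨g, α, _, hch, hRα, heig g α hαs, fun i =>
          coeff_multiset_prod_X_sub_C_mem L _
            (fun r hr => heig g r (Multiset.mem_of_mem_erase hr)) i⟩ hsimple
      · exact h
    choose c hc using hall
    have hscalar := forall_eq_smul_one_of_forall_charpoly_eq_pow_of_isIrreducible φ c hc
    refine ⟨1, fun g i j => ?_⟩
    rcases Nat.eq_zero_or_pos n with rfl | hn0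
    · exact Fin.elim0 i
    have hcL : c g ∈ L := heig g (c g) (by
      rw [hc g, Polynomial.roots_pow, Polynomial.roots_X_sub_C, Multiset.mem_nsmul]
      exact ⟨hn0.ne', Multiset.mem_singleton_self _⟩)
    rw [one_mul, inv_one, mul_one, hscalar g, Matrix.smul_apply, Matrix.one_apply, smul_eq_mul,
      mul_ite, mul_one, mul_zero]
    split_ifs
    · exact hcL
    · exact zero_mem L

/-- **An `L`-valued semisimplification in rank `≤ 3`.**  Every `φ : G → GL_n(k)`, `n ≤ 3`, all
of whose eigenvalues lie in `L` (`k` algebraically closed of characteristic `0`) admits an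
`L`-valued `ψ : G → GL_n(k)` with semisimple `kⁿ`, the same characteristic polynomials and
`ker φ ≤ ker ψ`.  Strong induction on `n` as in `exists_semisimplification`: an irreducible `φ`
is conjugated into `GL_n(L)` (`exists_conj_apply_mem_of_isIrreducible_of_le_three`); otherwise
dévissage along a proper non-zero stable subspace (`exists_blocks_of_subrepresentation`) gives
diagonal blocks of smaller rank whose eigenvalues are among those of `φ`, and the block-diagonal
sum (`exists_blockDiag_hom`) of their `L`-valued semisimplifications is semisimple
(`isSemisimpleRepresentation_of_blockDiag`), `L`-valued, with the required characteristic
polynomials and kernel. [folklore] -/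
theorem exists_semisimple_apply_mem_of_le_three [IsAlgClosed k] [CharZero k] (L : Subfield k) :
    ∀ {n : ℕ}, n ≤ 3 → ∀ (φ : G →* GL (Fin n) k),
      (∀ g, ∀ r ∈ ((φ g : GL (Fin n) k) : Matrix (Fin n) (Fin n) k).charpoly.roots, r ∈ L) →
      ∃ ψ : G →* GL (Fin n) k,
        Representation.IsSemisimpleRepresentation
          ((Representation.ofDistribMulAction k (GL (Fin n) k) (Fin n → k)).comp ψ) ∧
        (∀ g, ((ψ g : GL (Fin n) k) : Matrix (Fin n) (Fin n) k).charpoly =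
          ((φ g : GL (Fin n) k) : Matrix (Fin n) (Fin n) k).charpoly) ∧
        φ.ker ≤ ψ.ker ∧
        ∀ g i j, ((ψ g : GL (Fin n) k) : Matrix (Fin n) (Fin n) k) i j ∈ L := by
  intro n
  induction n using Nat.strong_induction_on with
  | _ n ih =>
    intro hn φ heig
    classical
    set R : Representation k G (Fin n → k) :=
      (Representation.ofDistribMulAction k (GL (Fin n) k) (Fin n → k)).comp φ with hRdef
    by_cases hirr : Representation.IsIrreducible R
    · -- conjugate into `GL_n(L)`
      haveI := hirr
      obtain ⟨P, hP⟩ := exists_conj_apply_mem_of_isIrreducible_of_le_three L hn φ heig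
      let ψ : G →* GL (Fin n) k := (MulAut.conj P).toMonoidHom.comp φ
      have hψ : ∀ g, ψ g = P * φ g * P⁻¹ := fun g => rfl
      have hcp : ∀ g, ((ψ g : GL (Fin n) k) : Matrix (Fin n) (Fin n) k).charpoly =
          ((φ g : GL (Fin n) k) : Matrix (Fin n) (Fin n) k).charpoly := fun g => by
        rw [hψ, Units.val_mul, Units.val_mul, Matrix.coe_units_inv, Matrix.charpoly_units_conj]
      refine ⟨ψ, ?_, hcp, fun g hg => ?_, fun g i j => hP g i j⟩
      · haveI : Representation.IsIrreducible
            ((Representation.ofDistribMulAction k (GL (Fin n) k) (Fin n → k)).comp ψ) :=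
          isIrreducible_of_charpoly_eq ψ φ hcp hirr
        infer_instance
      · rw [MonoidHom.mem_ker] at hg ⊢
        rw [hψ, hg, mul_one, mul_inv_cancel]
    · by_cases hbt : (⊥ : Subrepresentation R) = ⊤
      · -- the zero space: `φ` itself
        haveI : Subsingleton (Subrepresentation R) := subsingleton_of_bot_eq_top hbt
        have hn0 : n = 0 := by
          rcases Nat.eq_zero_or_pos n with h0 | hpos
          · exact h0
          · exfalso
            have hmem : (Pi.single (⟨0, hpos⟩ : Fin n) (1 : k) : Fin n → k) ∈
                (⊥ : Subrepresentation R) := by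
              rw [hbt]
              trivial
            have h0 : (Pi.single (⟨0, hpos⟩ : Fin n) (1 : k) : Fin n → k) = 0 := hmem
            exact (one_ne_zero (α := k)) (by simpa using congr_fun h0 ⟨0, hpos⟩)
        subst hn0
        refine ⟨φ, ⟨fun W => ⟨⊤, by rw [Subsingleton.elim W ⊥]; exact isCompl_bot_top⟩⟩,
          fun _ => rfl, le_rfl, fun g i j => Fin.elim0 i⟩
      · haveI : Nontrivial (Subrepresentation R) := ⟨⟨⊥, ⊤, hbt⟩⟩
        by_cases hW : ∃ W : Subrepresentation R, W ≠ ⊥ ∧ W ≠ ⊤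
        · -- dévissage
          obtain ⟨W, hW0, hW1⟩ := hW
          obtain ⟨m, p, hmn, hpn, e, A, D, hcp, hkerA, hkerD⟩ :=
            exists_blocks_of_subrepresentation φ W hW0 hW1
          have hne : ∀ g, ((A g : GL (Fin m) k) : Matrix (Fin m) (Fin m) k).charpoly *
              ((D g : GL (Fin p) k) : Matrix (Fin p) (Fin p) k).charpoly ≠ 0 := fun g =>
            (Monic.mul (Matrix.charpoly_monic _) (Matrix.charpoly_monic _)).ne_zero
          have heigA : ∀ g, ∀ r ∈ ((A g : GL (Fin m) k) : Matrix (Fin m) (Fin m) k).charpoly.roots,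
              r ∈ L := fun g r hr =>
            heig g r (by
              rw [hcp g, Polynomial.roots_mul (hne g)]
              exact Multiset.mem_add.mpr (Or.inl hr))
          have heigD : ∀ g, ∀ r ∈ ((D g : GL (Fin p) k) : Matrix (Fin p) (Fin p) k).charpoly.roots,
              r ∈ L := fun g r hr =>
            heig g r (by
              rw [hcp g, Polynomial.roots_mul (hne g)]
              exact Multiset.mem_add.mpr (Or.inr hr))
          obtain ⟨A', hA'ss, hA'cp, hA'ker, hA'L⟩ := ih m hmn (by omega) A heigA
          obtain ⟨D', hD'ss, hD'cp, hD'ker, hD'L⟩ := ih p hpn (by omega) D heigD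
          obtain ⟨ψ, hψ⟩ := exists_blockDiag_hom (k := k) e A' D'
          refine ⟨ψ, isSemisimpleRepresentation_of_blockDiag e hψ hA'ss hD'ss, fun g => ?_,
            fun g hg => ?_, fun g i j => ?_⟩
          · rw [hψ g, Matrix.charpoly_reindex, Matrix.charpoly_fromBlocks_zero₂₁, hA'cp, hD'cp,
              hcp]
          · have hA1 : A' g = 1 := hA'ker (hkerA hg)
            have hD1 : D' g = 1 := hD'ker (hkerD hg)
            rw [MonoidHom.mem_ker]
            refine Units.ext ?_
            rw [hψ g, hA1, hD1, Units.val_one, Units.val_one, Matrix.fromBlocks_one, Units.val_one,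
              Matrix.reindex_apply, Matrix.submatrix_one_equiv]
          · rw [hψ g, Matrix.reindex_apply, Matrix.submatrix_apply]
            rcases e.symm i with a | a <;> rcases e.symm j with a' | a'
            · rw [Matrix.fromBlocks_apply₁₁]
              exact hA'L g a a'
            · rw [Matrix.fromBlocks_apply₁₂]
              exact zero_mem L
            · rw [Matrix.fromBlocks_apply₂₁]
              exact zero_mem L
            · rw [Matrix.fromBlocks_apply₂₂]
              exact hD'L g a a'
        · -- every subrepresentation is `⊥` or `⊤`: `R` would be irreducible
          exfalso
          push Not at hW
          exact hirr ⟨fun W => or_iff_not_imp_left.mpr (hW W)⟩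

/-- **Semisimple representations of rank `≤ 3` with `L`-rational eigenvalues are conjugate into
`GL_n(L)`.**  If `kⁿ` is semisimple for `φ : G → GL_n(k)`, `n ≤ 3`, and all eigenvalues of all
`φ(g)` lie in `L` (`k` algebraically closed of characteristic `0`), then `P φ P⁻¹` is `L`-valued
for some `P ∈ GL_n(k)`: the `L`-valued semisimplification `ψ` of
`exists_semisimple_apply_mem_of_le_three` has the characteristic polynomials of `φ`, so by
Brauer–Nesbitt (`Representation.nonempty_equiv_of_charpoly_eq`) the two semisimple
representations are equivalent, i.e. conjugate. [folklore] -/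
theorem exists_conj_apply_mem_of_isSemisimple_of_le_three [IsAlgClosed k] [CharZero k]
    (L : Subfield k) {n : ℕ} (hn : n ≤ 3) (φ : G →* GL (Fin n) k)
    (hss : Representation.IsSemisimpleRepresentation
      ((Representation.ofDistribMulAction k (GL (Fin n) k) (Fin n → k)).comp φ))
    (heig : ∀ g, ∀ r ∈ ((φ g : GL (Fin n) k) : Matrix (Fin n) (Fin n) k).charpoly.roots, r ∈ L) :
    ∃ P : GL (Fin n) k, ∀ g i j,
      ((P * φ g * P⁻¹ : GL (Fin n) k) : Matrix (Fin n) (Fin n) k) i j ∈ L := by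
  classical
  obtain ⟨ψ, hψss, hcp, -, hL⟩ := exists_semisimple_apply_mem_of_le_three L hn φ heig
  set R : Representation k G (Fin n → k) :=
    (Representation.ofDistribMulAction k (GL (Fin n) k) (Fin n → k)).comp φ with hRdef
  set S : Representation k G (Fin n → k) :=
    (Representation.ofDistribMulAction k (GL (Fin n) k) (Fin n → k)).comp ψ with hSdef
  haveI : R.IsSemisimpleRepresentation := hss
  haveI : S.IsSemisimpleRepresentation := hψss
  obtain ⟨eqv⟩ := Representation.nonempty_equiv_of_charpoly_eq R S fun g => by
    rw [hRdef, hSdef, charpoly_ofDistribMulAction_comp_apply,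
      charpoly_ofDistribMulAction_comp_apply, hcp]
  -- the matrix of the equivalence
  set T : Matrix (Fin n) (Fin n) k := LinearMap.toMatrix' eqv.toLinearEquiv.toLinearMap with hTdef
  set T' : Matrix (Fin n) (Fin n) k := LinearMap.toMatrix' eqv.toLinearEquiv.symm.toLinearMap
    with hT'def
  have hTT' : T * T' = 1 := by
    rw [hTdef, hT'def, ← LinearMap.toMatrix'_comp, ← LinearMap.toMatrix'_id]
    congr 1
    exact LinearMap.ext fun v => eqv.toLinearEquiv.apply_symm_apply v
  have hT'T : T' * T = 1 := by
    rw [hTdef, hT'def, ← LinearMap.toMatrix'_comp, ← LinearMap.toMatrix'_id]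
    congr 1
    exact LinearMap.ext fun v => eqv.toLinearEquiv.symm_apply_apply v
  have hRg : ∀ g, (R g : (Fin n → k) →ₗ[k] (Fin n → k)) =
      Matrix.toLin' ((φ g : GL (Fin n) k) : Matrix (Fin n) (Fin n) k) := fun g =>
    LinearMap.ext fun v => by rw [Matrix.toLin'_apply]; rfl
  have hSg : ∀ g, (S g : (Fin n → k) →ₗ[k] (Fin n → k)) =
      Matrix.toLin' ((ψ g : GL (Fin n) k) : Matrix (Fin n) (Fin n) k) := fun g =>
    LinearMap.ext fun v => by rw [Matrix.toLin'_apply]; rfl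
  -- intertwining: `T φ(g) = ψ(g) T`
  have hinter : ∀ g, T * ((φ g : GL (Fin n) k) : Matrix (Fin n) (Fin n) k) =
      ((ψ g : GL (Fin n) k) : Matrix (Fin n) (Fin n) k) * T := fun g => by
    have h1 : eqv.toLinearEquiv.toLinearMap ∘ₗ R g = S g ∘ₗ eqv.toLinearEquiv.toLinearMap :=
      eqv.toIntertwiningMap.isIntertwining' g
    have h2 := congrArg LinearMap.toMatrix' h1
    rw [LinearMap.toMatrix'_comp, LinearMap.toMatrix'_comp, hRg, hSg, LinearMap.toMatrix'_toLin',
      LinearMap.toMatrix'_toLin'] at h2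
    exact h2
  refine ⟨⟨T, T', hTT', hT'T⟩, fun g i j => ?_⟩
  rw [Units.val_mul, Units.val_mul, Units.inv_mk]
  change (T * ((φ g : GL (Fin n) k) : Matrix (Fin n) (Fin n) k) * T') i j ∈ L
  rw [hinter, mul_assoc, hTT', mul_one]
  exact hL g i j

end

end Literature.RepresentationTheory.Semisimple

end
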